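import Summits.NavierStokesRegularity.NavierStokesRegularity.Theses.SymmetryModuliCount
import Summits.NavierStokesRegularity.NavierStokesRegularity.Theses.DulacContraction
import Summits.NavierStokesRegularity.NavierStokesRegularity.Theorems.SymmetryModuliCountForcedSymmetryCollapse
import Summits.NavierStokesRegularity.NavierStokesRegularity.Theorems.SymmetryModuliCountForcedSymmetryBlowDownResidual
import Summits.NavierStokesRegularity.NavierStokesRegularity.Theorems.SymmetryModuliCountForcedSymmetryRecurrentClosingNoSlack
import Summits.NavierStokesRegularity.NavierStokesRegularity.Theorems.RecurrentProfilesRecurrentReduction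
import Summits.NavierStokesRegularity.NavierStokesRegularity.Theorems.SymmetryModuliCountForcedSymmetryRecurrentClosingResidual
import Summits.NavierStokesRegularity.NavierStokesRegularity.Theorems.SymmetryModuliCountForcedSymmetryStubSlabProfileOfNonzero
import Summits.NavierStokesRegularity.NavierStokesRegularity.Theorems.SymmetryModuliCountForcedSymmetryStubSensitivityNormalization
import Summits.NavierStokesRegularity.NavierStokesRegularity.Theorems.SymmetryModuliCountForcedSymmetryClosingDichotomyGlue
import Literature.Analysis.FluidPDE.TypeIAncientMild
import HarnessLib

/-!
# Crux `ForcedSymmetry` (stmt-NavierStokesRegularity-4052), line `closing-dichotomy` — split glue and NO-SLACK certificate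

Support file (`--supports stmt-NavierStokesRegularity-4052`, registered sub-goal `forcedSymmetry_iff_closingDichotomyParts`;
lead c9).  The composition of the registered skeleton `Cruxes/ForcedSymmetry/Lines/closing_dichotomy.lean` (gen c9.2) with
its research stubs as HYPOTHESES, so that (i) a planner can `--split` the crux along them with this file as `--glue-by`
(census v3 §R9: children `SensitiveClosing` (new), `AlmostPeriodicLiouville` (new), `RDSSLiouvilleInClass` = stmt-8561
VERBATIM), and (ii) the ledger records that the split has NO SLACK: the crux is EQUIVALENT to the conjunction of the three
parts (each part is implied by `X = TypeIAncientLiouville ⇔ ForcedSymmetry`, vacuously — no singular class profile exists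
under `X`).

* `typeIAncientLiouville_of_closingDichotomyParts` — `SensitiveClosing → AlmostPeriodicLiouville → RDSSLiouvilleInClass → X`:
  bridge (p139433) → `recurrentReduction_proof` (stmt-1590) → periodic case by `classicalRepresentative_of_rdssProfile` +
  8561 → `orbitDichotomy` (p153609) → a.p. branch by APL / sensitive branch by `stub_sensitivityNormalization` (p152690) +
  SensitiveClosing + 8561 + `rdss_vanishes_of_not_singular` + `accumulation_endpoint`.
* `forcedSymmetry_of_closingDichotomyParts` — the same with the crux as conclusion (`forcedSymmetry_of_typeIAncientLiouville`).
* `forcedSymmetry_iff_closingDichotomyParts` — **NO SLACK**: `ForcedSymmetry ↔ (SensitiveClosing ∧ AlmostPeriodicLiouville ∧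
  RDSSLiouvilleInClass)`.

Honest reading (for the planner): as for every factorisation of `X` (c8, p149217), the conjunction of the open parts is
kernel-equivalent to the crux; what the re-typing buys is not slack but object-level content — three parts with three
disjoint single-object refutation targets (isolated sensitive aperiodic hull / quasi-periodic self-similar profile /
(R)DSS profile) and disjoint toolkits, two of which are not stmt-8561's.

## References

* D. Albritton, T. Barker, J. Math. Fluid Mech. 21 (2019), Thm 1.1, Lemma 2.2, Prop. 2.3, §3. [AlbrittonBarker2019]
* J. Auslander, J. Yorke, Tôhoku Math. J. 32 (1980), doi:10.2748/tmj/1178229634. [AuslanderYorke1980]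
* Z. Bradshaw, T.-P. Tsai, Comm. PDE 42 (2017), OP 5.1. [BradshawTsai2017CPDE]
* D. Chae, J. Wolf, arXiv:1610.09464, Thm 1.1/1.3. [ChaeWolf2017RemovingDSS]
-/

noncomputable section

-- the sub-problem namespace repeats the summit name (D-0017 layout `Summit.<S>.<P>.Theorems`)
set_option linter.dupNamespace false

open MeasureTheory Set Filter Topology Function

namespace Summit.NavierStokesRegularity.NavierStokesRegularity.Theorems.SymmetryModuliCountForcedSymmetry

open Literature.Analysis.FluidPDE Metric
open scoped ENNReal

/-- **The parts prove the route target `X`.**  `SensitiveClosing → AlmostPeriodicLiouville → RDSSLiouvilleInClass →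
TypeIAncientLiouville`: a nonzero `u ∈ A_C` gives a singular slab profile (bridge `stub_slabProfileOfNonzero`, p139433),
hence a uniformly recurrent singular one `U` (`recurrentReduction_proof`); if `U` is RDSS in stmt-8561's sense its classical
representative contradicts `RDSSLiouvilleInClass`; otherwise `orbitDichotomy`: the almost-periodic branch is
`AlmostPeriodicLiouville`, the sensitive branch is normalised to `Q(0,1)` (`stub_sensitivityNormalization`) and closed by
`SensitiveClosing` + `RDSSLiouvilleInClass` + `rdss_vanishes_of_not_singular` + `accumulation_endpoint`.
[cite: AlbrittonBarker2019, Lemma 2.2, Prop. 2.3, §3; AuslanderYorke1980, Thm 1; ChaeWolf2017RemovingDSS, Thm 1.1] -/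
theorem typeIAncientLiouville_of_closingDichotomyParts :
    (∀ (u : ℝ → EuclideanSpace ℝ (Fin 3) → EuclideanSpace ℝ (Fin 3)) (p : ℝ → EuclideanSpace ℝ (Fin 3) → ℝ) (G : ℝ → EuclideanSpace ℝ (Fin 3) → EuclideanSpace ℝ (Fin 3) →L[ℝ] EuclideanSpace ℝ (Fin 3)) (C : ℝ),
       IsSuitableWeakSolutionOn (slab (EuclideanSpace ℝ (Fin 3)) (Set.Iio 0) isOpen_Iio) 1 0 u p →
       HasWeakSpatialGradientOn (slab (EuclideanSpace ℝ (Fin 3)) (Set.Iio 0) isOpen_Iio) u G →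
       typeIBound (Set.Iio (0 : ℝ) ×ˢ Set.univ) u p G < ⊤ →
       HasTypeITimeDecay C u →
       (∀ ε : ℝ, 0 < ε → ∀ K : Set (ℝ × EuclideanSpace ℝ (Fin 3)), IsCompact K → K ⊆ Set.Iic (0 : ℝ) ×ˢ Set.univ →
         ∃ L : ℝ, 0 < L ∧ ∀ a : ℝ, ∃ σ ∈ Set.Icc a (a + L),
           eLpNorm (fun z : ℝ × EuclideanSpace ℝ (Fin 3) => nsRescale (Real.exp σ) u z.1 z.2 - u z.1 z.2) 3
             (volume.restrict K) ≤ ENNReal.ofReal ε) →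
       IsBackwardSingularPoint u 0 →
       (¬ ∃ l : ℝ, 1 < l ∧ ∃ (R : EuclideanSpace ℝ (Fin 3) ≃ₗᵢ[ℝ] EuclideanSpace ℝ (Fin 3)) (ξ : EuclideanSpace ℝ (Fin 3)) (τ : ℝ), τ ≤ 0 ∧
           (fun z : ℝ × EuclideanSpace ℝ (Fin 3) => l • R.symm (u (l ^ 2 * z.1 + τ) (l • R z.2 + ξ)))
             =ᵐ[volume.restrict (Set.Iio (0 : ℝ) ×ˢ Set.univ)] (fun z : ℝ × EuclideanSpace ℝ (Fin 3) => u z.1 z.2)) →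
       (∃ δ : ℝ, 0 < δ ∧
         ∀ ε : ℝ, 0 < ε → ∀ K : Set (ℝ × EuclideanSpace ℝ (Fin 3)), IsCompact K → K ⊆ Set.Iic (0 : ℝ) ×ˢ Set.univ →
           ∃ σ : ℝ, eLpNorm (fun z : ℝ × EuclideanSpace ℝ (Fin 3) => nsRescale (Real.exp σ) u z.1 z.2 - u z.1 z.2) 3
               (volume.restrict K) ≤ ENNReal.ofReal ε ∧
             ∃ s : ℝ, ENNReal.ofReal δ < eLpNorm (fun z : ℝ × EuclideanSpace ℝ (Fin 3) =>
                 nsRescale (Real.exp σ) (nsRescale (Real.exp s) u) z.1 z.2 - nsRescale (Real.exp s) u z.1 z.2) 3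
               (volume.restrict (parabolicCylinder 1 (0 : ℝ × EuclideanSpace ℝ (Fin 3))))) →
       ∀ ε : ℝ, 0 < ε →
         ∃ (w : ℝ → EuclideanSpace ℝ (Fin 3) → EuclideanSpace ℝ (Fin 3)) (q : ℝ → EuclideanSpace ℝ (Fin 3) → ℝ) (H : ℝ → EuclideanSpace ℝ (Fin 3) → EuclideanSpace ℝ (Fin 3) →L[ℝ] EuclideanSpace ℝ (Fin 3)) (C' : ℝ),
           IsSuitableWeakSolutionOn (slab (EuclideanSpace ℝ (Fin 3)) (Set.Iio 0) isOpen_Iio) 1 0 w q ∧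
           HasWeakSpatialGradientOn (slab (EuclideanSpace ℝ (Fin 3)) (Set.Iio 0) isOpen_Iio) w H ∧
           typeIBound (Set.Iio (0 : ℝ) ×ˢ Set.univ) w q H < ⊤ ∧
           HasTypeITimeDecay C' w ∧
           IsClassicalNSSolutionOn (Set.Iio 0) 1 0 w q ∧
           (∃ l : ℝ, 1 < l ∧ ∃ R : EuclideanSpace ℝ (Fin 3) ≃ₗᵢ[ℝ] EuclideanSpace ℝ (Fin 3),
             (fun z : ℝ × EuclideanSpace ℝ (Fin 3) => l • R.symm (w (l ^ 2 * z.1) (l • R z.2)))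
               =ᵐ[volume.restrict (Set.Iio (0 : ℝ) ×ˢ Set.univ)] (fun z : ℝ × EuclideanSpace ℝ (Fin 3) => w z.1 z.2)) ∧
           eLpNorm (fun z : ℝ × EuclideanSpace ℝ (Fin 3) => w z.1 z.2 - u z.1 z.2) 3
             (volume.restrict (parabolicCylinder 1 (0 : ℝ × EuclideanSpace ℝ (Fin 3)))) ≤ ENNReal.ofReal ε) →
    (∀ (u : ℝ → EuclideanSpace ℝ (Fin 3) → EuclideanSpace ℝ (Fin 3)) (p : ℝ → EuclideanSpace ℝ (Fin 3) → ℝ) (G : ℝ → EuclideanSpace ℝ (Fin 3) → EuclideanSpace ℝ (Fin 3) →L[ℝ] EuclideanSpace ℝ (Fin 3)) (C : ℝ),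
       IsSuitableWeakSolutionOn (slab (EuclideanSpace ℝ (Fin 3)) (Set.Iio 0) isOpen_Iio) 1 0 u p →
       HasWeakSpatialGradientOn (slab (EuclideanSpace ℝ (Fin 3)) (Set.Iio 0) isOpen_Iio) u G →
       typeIBound (Set.Iio (0 : ℝ) ×ˢ Set.univ) u p G < ⊤ →
       HasTypeITimeDecay C u →
       (∀ ε : ℝ, 0 < ε → ∀ K : Set (ℝ × EuclideanSpace ℝ (Fin 3)), IsCompact K → K ⊆ Set.Iic (0 : ℝ) ×ˢ Set.univ →
         ∃ L : ℝ, 0 < L ∧ ∀ a : ℝ, ∃ σ ∈ Set.Icc a (a + L), ∀ s : ℝ,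
           eLpNorm (fun z : ℝ × EuclideanSpace ℝ (Fin 3) =>
               nsRescale (Real.exp σ) (nsRescale (Real.exp s) u) z.1 z.2 - nsRescale (Real.exp s) u z.1 z.2) 3
             (volume.restrict K) ≤ ENNReal.ofReal ε) →
       (¬ ∃ l : ℝ, 1 < l ∧ ∃ (R : EuclideanSpace ℝ (Fin 3) ≃ₗᵢ[ℝ] EuclideanSpace ℝ (Fin 3)) (ξ : EuclideanSpace ℝ (Fin 3)) (τ : ℝ), τ ≤ 0 ∧
           (fun z : ℝ × EuclideanSpace ℝ (Fin 3) => l • R.symm (u (l ^ 2 * z.1 + τ) (l • R z.2 + ξ)))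
             =ᵐ[volume.restrict (Set.Iio (0 : ℝ) ×ˢ Set.univ)] (fun z : ℝ × EuclideanSpace ℝ (Fin 3) => u z.1 z.2)) →
       ¬ IsBackwardSingularPoint u 0) →
    Summit.NavierStokesRegularity.NavierStokesRegularity.Theses.DulacContraction.RDSSLiouvilleInClass →
    Summit.NavierStokesRegularity.NavierStokesRegularity.Theses.SymmetryModuliCount.TypeIAncientLiouville := by
  intro hSC hAPL h8561 C u hu t ht x
  by_contra hx
  have hu' : IsTypeIAncientMild C u := isTypeIAncientMild_iff.2 hu
  obtain ⟨w, q, G, C', hw, hG, hI, hC', hsing⟩ := stub_slabProfileOfNonzero C u hu' ⟨t, ht, x, hx⟩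
  obtain ⟨U, P, H, hU, hH, hIU, hCU, hsingU, hrecU⟩ :=
    Summit.NavierStokesRegularity.NavierStokesRegularity.Theorems.recurrentReduction_proof w q G C' hw hG hI hC' hsing
  -- the periodic case: `U` rotated-discretely self-similar in stmt-8561's sense
  by_cases hper : ∃ l : ℝ, 1 < l ∧ ∃ (R : EuclideanSpace ℝ (Fin 3) ≃ₗᵢ[ℝ] EuclideanSpace ℝ (Fin 3))
      (ξ : EuclideanSpace ℝ (Fin 3)) (τ : ℝ), τ ≤ 0 ∧
      (fun z : ℝ × EuclideanSpace ℝ (Fin 3) => l • R.symm (U (l ^ 2 * z.1 + τ) (l • R z.2 + ξ)))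
        =ᵐ[volume.restrict (Set.Iio (0 : ℝ) ×ˢ Set.univ)] (fun z : ℝ × EuclideanSpace ℝ (Fin 3) => U z.1 z.2)
  · obtain ⟨w', q', H', C'', h1, h2, h3, h4, h5, h6, h7⟩ :=
      classicalRepresentative_of_rdssProfile hU hIU hCU hper hsingU
    exact h8561 w' q' H' C'' h1 h2 h3 h4 h5 h6 h7
  -- the aperiodic case: the orbit dichotomy
  rcases orbitDichotomy U hrecU with hap | hsensK
  · exact hAPL U P H C' hU hH hIU hCU hap hper hsingU
  · have hsens := Summit.NavierStokesRegularity.NavierStokesRegularity.Theorems.stub_sensitivityNormalization U hsensK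
    have hacc := hSC U P H C' hU hH hIU hCU hrecU hsingU hper hsens
    refine accumulation_endpoint hH hIU (fun n => ?_) hsingU
    obtain ⟨wn, qn, Hn, Cn, hswn, hwgn, hIn, hdecn, hcln, ⟨l, hl, R, hae⟩, hclose⟩ :=
      hacc (1 / ((n : ℝ) + 1)) (by positivity)
    have hreg : ¬ IsBackwardSingularPoint wn 0 :=
      h8561 wn qn Hn Cn hswn hwgn hIn hdecn hcln ⟨l, hl, R, 0, 0, le_rfl, by simpa only [add_zero] using hae⟩
    have hvan : ∀ t < (0 : ℝ), ∀ x : EuclideanSpace ℝ (Fin 3), wn t x = 0 :=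
      rdss_vanishes_of_not_singular hcln hl hae hreg
    have hEq : ∀ z ∈ parabolicCylinder 1 (0 : ℝ × EuclideanSpace ℝ (Fin 3)),
        (fun z : ℝ × EuclideanSpace ℝ (Fin 3) => wn z.1 z.2 - U z.1 z.2) z =
          (fun z : ℝ × EuclideanSpace ℝ (Fin 3) => -(U z.1 z.2)) z := by
      intro z hz
      have hz' := parabolicCylinder_origin_subset_slab 1 hz
      have ht' : z.1 < 0 := hz'.1
      simp only [hvan z.1 ht' z.2, zero_sub]
    have hcongr : eLpNorm (fun z : ℝ × EuclideanSpace ℝ (Fin 3) => wn z.1 z.2 - U z.1 z.2) 3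
        (volume.restrict (parabolicCylinder 1 (0 : ℝ × EuclideanSpace ℝ (Fin 3)))) =
        eLpNorm (fun z : ℝ × EuclideanSpace ℝ (Fin 3) => U z.1 z.2) 3
          (volume.restrict (parabolicCylinder 1 (0 : ℝ × EuclideanSpace ℝ (Fin 3)))) := by
      rw [eLpNorm_congr_ae (ae_restrict_of_forall_mem (isOpen_parabolicCylinder 1 _).measurableSet hEq)]
      exact eLpNorm_neg (fun z : ℝ × EuclideanSpace ℝ (Fin 3) => U z.1 z.2) 3 _
    rw [← hcongr]
    exact hclose

/-- **Split glue: the parts prove the crux BY NAME** (`--glue-by` theorem for the route-level `--split` of census v3 §R9):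
`SensitiveClosing → AlmostPeriodicLiouville → RDSSLiouvilleInClass → ForcedSymmetry`, through `X` and the landed collapse
`forcedSymmetry_of_typeIAncientLiouville`. [cite: AlbrittonBarker2019, Thm 1.1, §3] -/
theorem forcedSymmetry_of_closingDichotomyParts :
    (∀ (u : ℝ → EuclideanSpace ℝ (Fin 3) → EuclideanSpace ℝ (Fin 3)) (p : ℝ → EuclideanSpace ℝ (Fin 3) → ℝ) (G : ℝ → EuclideanSpace ℝ (Fin 3) → EuclideanSpace ℝ (Fin 3) →L[ℝ] EuclideanSpace ℝ (Fin 3)) (C : ℝ),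
       IsSuitableWeakSolutionOn (slab (EuclideanSpace ℝ (Fin 3)) (Set.Iio 0) isOpen_Iio) 1 0 u p →
       HasWeakSpatialGradientOn (slab (EuclideanSpace ℝ (Fin 3)) (Set.Iio 0) isOpen_Iio) u G →
       typeIBound (Set.Iio (0 : ℝ) ×ˢ Set.univ) u p G < ⊤ →
       HasTypeITimeDecay C u →
       (∀ ε : ℝ, 0 < ε → ∀ K : Set (ℝ × EuclideanSpace ℝ (Fin 3)), IsCompact K → K ⊆ Set.Iic (0 : ℝ) ×ˢ Set.univ →
         ∃ L : ℝ, 0 < L ∧ ∀ a : ℝ, ∃ σ ∈ Set.Icc a (a + L),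
           eLpNorm (fun z : ℝ × EuclideanSpace ℝ (Fin 3) => nsRescale (Real.exp σ) u z.1 z.2 - u z.1 z.2) 3
             (volume.restrict K) ≤ ENNReal.ofReal ε) →
       IsBackwardSingularPoint u 0 →
       (¬ ∃ l : ℝ, 1 < l ∧ ∃ (R : EuclideanSpace ℝ (Fin 3) ≃ₗᵢ[ℝ] EuclideanSpace ℝ (Fin 3)) (ξ : EuclideanSpace ℝ (Fin 3)) (τ : ℝ), τ ≤ 0 ∧
           (fun z : ℝ × EuclideanSpace ℝ (Fin 3) => l • R.symm (u (l ^ 2 * z.1 + τ) (l • R z.2 + ξ)))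
             =ᵐ[volume.restrict (Set.Iio (0 : ℝ) ×ˢ Set.univ)] (fun z : ℝ × EuclideanSpace ℝ (Fin 3) => u z.1 z.2)) →
       (∃ δ : ℝ, 0 < δ ∧
         ∀ ε : ℝ, 0 < ε → ∀ K : Set (ℝ × EuclideanSpace ℝ (Fin 3)), IsCompact K → K ⊆ Set.Iic (0 : ℝ) ×ˢ Set.univ →
           ∃ σ : ℝ, eLpNorm (fun z : ℝ × EuclideanSpace ℝ (Fin 3) => nsRescale (Real.exp σ) u z.1 z.2 - u z.1 z.2) 3
               (volume.restrict K) ≤ ENNReal.ofReal ε ∧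
             ∃ s : ℝ, ENNReal.ofReal δ < eLpNorm (fun z : ℝ × EuclideanSpace ℝ (Fin 3) =>
                 nsRescale (Real.exp σ) (nsRescale (Real.exp s) u) z.1 z.2 - nsRescale (Real.exp s) u z.1 z.2) 3
               (volume.restrict (parabolicCylinder 1 (0 : ℝ × EuclideanSpace ℝ (Fin 3))))) →
       ∀ ε : ℝ, 0 < ε →
         ∃ (w : ℝ → EuclideanSpace ℝ (Fin 3) → EuclideanSpace ℝ (Fin 3)) (q : ℝ → EuclideanSpace ℝ (Fin 3) → ℝ) (H : ℝ → EuclideanSpace ℝ (Fin 3) → EuclideanSpace ℝ (Fin 3) →L[ℝ] EuclideanSpace ℝ (Fin 3)) (C' : ℝ),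
           IsSuitableWeakSolutionOn (slab (EuclideanSpace ℝ (Fin 3)) (Set.Iio 0) isOpen_Iio) 1 0 w q ∧
           HasWeakSpatialGradientOn (slab (EuclideanSpace ℝ (Fin 3)) (Set.Iio 0) isOpen_Iio) w H ∧
           typeIBound (Set.Iio (0 : ℝ) ×ˢ Set.univ) w q H < ⊤ ∧
           HasTypeITimeDecay C' w ∧
           IsClassicalNSSolutionOn (Set.Iio 0) 1 0 w q ∧
           (∃ l : ℝ, 1 < l ∧ ∃ R : EuclideanSpace ℝ (Fin 3) ≃ₗᵢ[ℝ] EuclideanSpace ℝ (Fin 3),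
             (fun z : ℝ × EuclideanSpace ℝ (Fin 3) => l • R.symm (w (l ^ 2 * z.1) (l • R z.2)))
               =ᵐ[volume.restrict (Set.Iio (0 : ℝ) ×ˢ Set.univ)] (fun z : ℝ × EuclideanSpace ℝ (Fin 3) => w z.1 z.2)) ∧
           eLpNorm (fun z : ℝ × EuclideanSpace ℝ (Fin 3) => w z.1 z.2 - u z.1 z.2) 3
             (volume.restrict (parabolicCylinder 1 (0 : ℝ × EuclideanSpace ℝ (Fin 3)))) ≤ ENNReal.ofReal ε) →
    (∀ (u : ℝ → EuclideanSpace ℝ (Fin 3) → EuclideanSpace ℝ (Fin 3)) (p : ℝ → EuclideanSpace ℝ (Fin 3) → ℝ) (G : ℝ → EuclideanSpace ℝ (Fin 3) → EuclideanSpace ℝ (Fin 3) →L[ℝ] EuclideanSpace ℝ (Fin 3)) (C : ℝ),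
       IsSuitableWeakSolutionOn (slab (EuclideanSpace ℝ (Fin 3)) (Set.Iio 0) isOpen_Iio) 1 0 u p →
       HasWeakSpatialGradientOn (slab (EuclideanSpace ℝ (Fin 3)) (Set.Iio 0) isOpen_Iio) u G →
       typeIBound (Set.Iio (0 : ℝ) ×ˢ Set.univ) u p G < ⊤ →
       HasTypeITimeDecay C u →
       (∀ ε : ℝ, 0 < ε → ∀ K : Set (ℝ × EuclideanSpace ℝ (Fin 3)), IsCompact K → K ⊆ Set.Iic (0 : ℝ) ×ˢ Set.univ →
         ∃ L : ℝ, 0 < L ∧ ∀ a : ℝ, ∃ σ ∈ Set.Icc a (a + L), ∀ s : ℝ,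
           eLpNorm (fun z : ℝ × EuclideanSpace ℝ (Fin 3) =>
               nsRescale (Real.exp σ) (nsRescale (Real.exp s) u) z.1 z.2 - nsRescale (Real.exp s) u z.1 z.2) 3
             (volume.restrict K) ≤ ENNReal.ofReal ε) →
       (¬ ∃ l : ℝ, 1 < l ∧ ∃ (R : EuclideanSpace ℝ (Fin 3) ≃ₗᵢ[ℝ] EuclideanSpace ℝ (Fin 3)) (ξ : EuclideanSpace ℝ (Fin 3)) (τ : ℝ), τ ≤ 0 ∧
           (fun z : ℝ × EuclideanSpace ℝ (Fin 3) => l • R.symm (u (l ^ 2 * z.1 + τ) (l • R z.2 + ξ)))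
             =ᵐ[volume.restrict (Set.Iio (0 : ℝ) ×ˢ Set.univ)] (fun z : ℝ × EuclideanSpace ℝ (Fin 3) => u z.1 z.2)) →
       ¬ IsBackwardSingularPoint u 0) →
    Summit.NavierStokesRegularity.NavierStokesRegularity.Theses.DulacContraction.RDSSLiouvilleInClass →
    Summit.NavierStokesRegularity.NavierStokesRegularity.Theses.SymmetryModuliCount.ForcedSymmetry :=
  fun hSC hAPL h8561 =>
    Summit.NavierStokesRegularity.NavierStokesRegularity.Theorems.forcedSymmetry_of_typeIAncientLiouville
      (typeIAncientLiouville_of_closingDichotomyParts hSC hAPL h8561)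

/-- **NO SLACK for line `closing-dichotomy` (registered sub-goal): `ForcedSymmetry ↔ (SensitiveClosing ∧
AlmostPeriodicLiouville ∧ RDSSLiouvilleInClass)`.**  `←` is the split glue; `→`: the crux gives `X`
(`forcedSymmetry_iff_typeIAncientLiouville`), under which no profile of the slab class is singular at the origin
(`noTypeIRateProfile_of_typeIAncientLiouville`), so `SensitiveClosing` holds vacuously (its hypotheses contain a singular
profile), `AlmostPeriodicLiouville` holds outright, and `RDSSLiouvilleInClass` is `rdssLiouvilleInClass_of_typeIAncientLiouville`.
So the three open parts are each IMPLIED BY the crux and jointly EQUIVALENT to it: no reshape inside this composition makes a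
part easier than "crux minus the other two"; the gain of the line is object-level content, not slack.
[cite: AlbrittonBarker2019, Thm 1.1, §3; BradshawTsai2017CPDE, OP 5.1] -/
theorem forcedSymmetry_iff_closingDichotomyParts :
    Summit.NavierStokesRegularity.NavierStokesRegularity.Theses.SymmetryModuliCount.ForcedSymmetry ↔
    ((∀ (u : ℝ → EuclideanSpace ℝ (Fin 3) → EuclideanSpace ℝ (Fin 3)) (p : ℝ → EuclideanSpace ℝ (Fin 3) → ℝ) (G : ℝ → EuclideanSpace ℝ (Fin 3) → EuclideanSpace ℝ (Fin 3) →L[ℝ] EuclideanSpace ℝ (Fin 3)) (C : ℝ),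
       IsSuitableWeakSolutionOn (slab (EuclideanSpace ℝ (Fin 3)) (Set.Iio 0) isOpen_Iio) 1 0 u p →
       HasWeakSpatialGradientOn (slab (EuclideanSpace ℝ (Fin 3)) (Set.Iio 0) isOpen_Iio) u G →
       typeIBound (Set.Iio (0 : ℝ) ×ˢ Set.univ) u p G < ⊤ →
       HasTypeITimeDecay C u →
       (∀ ε : ℝ, 0 < ε → ∀ K : Set (ℝ × EuclideanSpace ℝ (Fin 3)), IsCompact K → K ⊆ Set.Iic (0 : ℝ) ×ˢ Set.univ →
         ∃ L : ℝ, 0 < L ∧ ∀ a : ℝ, ∃ σ ∈ Set.Icc a (a + L),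
           eLpNorm (fun z : ℝ × EuclideanSpace ℝ (Fin 3) => nsRescale (Real.exp σ) u z.1 z.2 - u z.1 z.2) 3
             (volume.restrict K) ≤ ENNReal.ofReal ε) →
       IsBackwardSingularPoint u 0 →
       (¬ ∃ l : ℝ, 1 < l ∧ ∃ (R : EuclideanSpace ℝ (Fin 3) ≃ₗᵢ[ℝ] EuclideanSpace ℝ (Fin 3)) (ξ : EuclideanSpace ℝ (Fin 3)) (τ : ℝ), τ ≤ 0 ∧
           (fun z : ℝ × EuclideanSpace ℝ (Fin 3) => l • R.symm (u (l ^ 2 * z.1 + τ) (l • R z.2 + ξ)))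
             =ᵐ[volume.restrict (Set.Iio (0 : ℝ) ×ˢ Set.univ)] (fun z : ℝ × EuclideanSpace ℝ (Fin 3) => u z.1 z.2)) →
       (∃ δ : ℝ, 0 < δ ∧
         ∀ ε : ℝ, 0 < ε → ∀ K : Set (ℝ × EuclideanSpace ℝ (Fin 3)), IsCompact K → K ⊆ Set.Iic (0 : ℝ) ×ˢ Set.univ →
           ∃ σ : ℝ, eLpNorm (fun z : ℝ × EuclideanSpace ℝ (Fin 3) => nsRescale (Real.exp σ) u z.1 z.2 - u z.1 z.2) 3
               (volume.restrict K) ≤ ENNReal.ofReal ε ∧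
             ∃ s : ℝ, ENNReal.ofReal δ < eLpNorm (fun z : ℝ × EuclideanSpace ℝ (Fin 3) =>
                 nsRescale (Real.exp σ) (nsRescale (Real.exp s) u) z.1 z.2 - nsRescale (Real.exp s) u z.1 z.2) 3
               (volume.restrict (parabolicCylinder 1 (0 : ℝ × EuclideanSpace ℝ (Fin 3))))) →
       ∀ ε : ℝ, 0 < ε →
         ∃ (w : ℝ → EuclideanSpace ℝ (Fin 3) → EuclideanSpace ℝ (Fin 3)) (q : ℝ → EuclideanSpace ℝ (Fin 3) → ℝ) (H : ℝ → EuclideanSpace ℝ (Fin 3) → EuclideanSpace ℝ (Fin 3) →L[ℝ] EuclideanSpace ℝ (Fin 3)) (C' : ℝ),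
           IsSuitableWeakSolutionOn (slab (EuclideanSpace ℝ (Fin 3)) (Set.Iio 0) isOpen_Iio) 1 0 w q ∧
           HasWeakSpatialGradientOn (slab (EuclideanSpace ℝ (Fin 3)) (Set.Iio 0) isOpen_Iio) w H ∧
           typeIBound (Set.Iio (0 : ℝ) ×ˢ Set.univ) w q H < ⊤ ∧
           HasTypeITimeDecay C' w ∧
           IsClassicalNSSolutionOn (Set.Iio 0) 1 0 w q ∧
           (∃ l : ℝ, 1 < l ∧ ∃ R : EuclideanSpace ℝ (Fin 3) ≃ₗᵢ[ℝ] EuclideanSpace ℝ (Fin 3),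
             (fun z : ℝ × EuclideanSpace ℝ (Fin 3) => l • R.symm (w (l ^ 2 * z.1) (l • R z.2)))
               =ᵐ[volume.restrict (Set.Iio (0 : ℝ) ×ˢ Set.univ)] (fun z : ℝ × EuclideanSpace ℝ (Fin 3) => w z.1 z.2)) ∧
           eLpNorm (fun z : ℝ × EuclideanSpace ℝ (Fin 3) => w z.1 z.2 - u z.1 z.2) 3
             (volume.restrict (parabolicCylinder 1 (0 : ℝ × EuclideanSpace ℝ (Fin 3)))) ≤ ENNReal.ofReal ε) ∧
    (∀ (u : ℝ → EuclideanSpace ℝ (Fin 3) → EuclideanSpace ℝ (Fin 3)) (p : ℝ → EuclideanSpace ℝ (Fin 3) → ℝ) (G : ℝ → EuclideanSpace ℝ (Fin 3) → EuclideanSpace ℝ (Fin 3) →L[ℝ] EuclideanSpace ℝ (Fin 3)) (C : ℝ),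
       IsSuitableWeakSolutionOn (slab (EuclideanSpace ℝ (Fin 3)) (Set.Iio 0) isOpen_Iio) 1 0 u p →
       HasWeakSpatialGradientOn (slab (EuclideanSpace ℝ (Fin 3)) (Set.Iio 0) isOpen_Iio) u G →
       typeIBound (Set.Iio (0 : ℝ) ×ˢ Set.univ) u p G < ⊤ →
       HasTypeITimeDecay C u →
       (∀ ε : ℝ, 0 < ε → ∀ K : Set (ℝ × EuclideanSpace ℝ (Fin 3)), IsCompact K → K ⊆ Set.Iic (0 : ℝ) ×ˢ Set.univ →
         ∃ L : ℝ, 0 < L ∧ ∀ a : ℝ, ∃ σ ∈ Set.Icc a (a + L), ∀ s : ℝ,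
           eLpNorm (fun z : ℝ × EuclideanSpace ℝ (Fin 3) =>
               nsRescale (Real.exp σ) (nsRescale (Real.exp s) u) z.1 z.2 - nsRescale (Real.exp s) u z.1 z.2) 3
             (volume.restrict K) ≤ ENNReal.ofReal ε) →
       (¬ ∃ l : ℝ, 1 < l ∧ ∃ (R : EuclideanSpace ℝ (Fin 3) ≃ₗᵢ[ℝ] EuclideanSpace ℝ (Fin 3)) (ξ : EuclideanSpace ℝ (Fin 3)) (τ : ℝ), τ ≤ 0 ∧
           (fun z : ℝ × EuclideanSpace ℝ (Fin 3) => l • R.symm (u (l ^ 2 * z.1 + τ) (l • R z.2 + ξ)))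
             =ᵐ[volume.restrict (Set.Iio (0 : ℝ) ×ˢ Set.univ)] (fun z : ℝ × EuclideanSpace ℝ (Fin 3) => u z.1 z.2)) →
       ¬ IsBackwardSingularPoint u 0) ∧
    Summit.NavierStokesRegularity.NavierStokesRegularity.Theses.DulacContraction.RDSSLiouvilleInClass) := by
  constructor
  · intro hF
    have hX : Summit.NavierStokesRegularity.NavierStokesRegularity.Theses.SymmetryModuliCount.TypeIAncientLiouville :=
      forcedSymmetry_iff_typeIAncientLiouville.1 hF
    refine ⟨?_, ?_, rdssLiouvilleInClass_of_typeIAncientLiouville hX⟩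
    · intro u p G C hsw hwg hI hdec _hrec hsing _hper _hsens
      exact absurd hsing (noTypeIRateProfile_of_typeIAncientLiouville hX u p G C hsw hwg hI hdec)
    · intro u p G C hsw hwg hI hdec _hap _hper
      exact noTypeIRateProfile_of_typeIAncientLiouville hX u p G C hsw hwg hI hdec
  · rintro ⟨hSC, hAPL, h8561⟩
    exact forcedSymmetry_of_closingDichotomyParts hSC hAPL h8561

end Summit.NavierStokesRegularity.NavierStokesRegularity.Theorems.SymmetryModuliCountForcedSymmetry

end
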